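import Summits.ABC.IUTFork.Repair.RHSzpiroBadCut
import Summits.ABC.IUTFork.Cor312ProvKChosenQIdeleNorm
import Summits.ABC.IUTFork.Cor312NotLicencePrVolSharpRealises
import Literature.IUT.LogVolume.Corollary22LegendreDeepAdmissiblePairs
import HarnessLib

/-!
# D-0079 RESCUE sub-cell R-H, ROUND 1 row 2 «szpiro-bad-datum-cut»: the KILL at a NAMED GENUINE DATUM CLASS, in kernel —
# at the Reyssat point `λ = 2/23⁵` (abc triple `2 + 3¹⁰·109 = 23⁵`, R-W datum `pilotDataOfK:frey-2-6436341-6436343:13`) and `l = 13`,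
# EVERY Θ-volume datum `T` violates the I06⋆ data clause `RHSzpiroBadCut.I06StarCellsAt T` (top label at any place over `3`), MODEL-FREE

PROOF-ONLY file (0 definitions, 0 `Prop` facts; abc-iut cell, rung LADDER-ABC:A2.RESCUE.H; seat abc-iut-rh-typ-2 = typer of pair n = 2).
TAKES NO SIDE on [IUTchIII] Cor. 3.12 or on any author; `I06StarCellsAt` / `HStarSzpiroBadCut` are HYPOTHESES (claim-tagged); a statement about OUR
typed objects; typed ≠ proved; refuted-as-typed ≠ refuted-in-print. Nothing here constructs a Θ-volume datum at the Reyssat point (existence of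
initial Θ-data there is NOT claimed); the theorem is «for every such datum, IF it exists».

INPUTS (BY NAME): abc-iut-w4-d026's chosen-q-idele norm package `Cor312Prov.norm_chosenQIdele_le_rpow_of_ratPoint'` / `norm_chosenQIdele_eq_rpow_ord_rat'`
/ `natGenerator_finBelow_placeOf` (every `x₀ | p` over a pole of `j(λ)` with `p ≠ 2, l` is BAD and `‖t_q(x₀)‖ = p^{ord_p(j(λ))/(2l)}`), abc-iut-w5-d236's
`Thm311.Real.norm_thetaIdele_eq_pow_of_realises` (`‖t_{Θ,j}‖ = ‖t_q‖^{j²}`), abc-iut-rp-x3's two-element NEG door `EvalI06StarGenuine.not_mem_smul_logShell_of_lt`,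
the degree chain of `RHSzpiroBadCut` §4 (`logRadiusB_le`, `absRamificationIdx_le_finrank`, `finrank_kOf_le`, `ThetaVolumeDatumAt.finrank_rat_K_le_ratPoint`),
and the `ord` calculus of campaign S (`ord_mul`, `ord_inv`, `ord_pow`, `ord_natCast_eq_zero_of_not_dvd'`, `Cor22.ord_natGenerator_eq_one`).

§1 `jInv_reyssat_eq` — `j(2/23⁵) = 2⁸·N³/((abc)²)` with `N = a² − ac + c² = 41426498340967`, `(abc)² = 3²⁰·M²`, `M = 2·109·23⁵ = 1403122774`;
   `ord_jInv_reyssat` — `ord₃ j(2/23⁵) = −20` (`3 ∤ 2⁸N³`, `3 ∤ M`).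
§2 `exists_bad_place_three_reyssat` — for every `T : Cor22.ThetaVolumeDatumAt (ratPoint (2/23⁵)) 13` there is a fibre point `x₀ | 3`, BAD for
   `pilotDataOfK T.D T.K`, with `‖t_q(x₀)‖ = 3^{−20/26}` for the CHOSEN realising q-idele.
§3 **`not_i06StarCellsAt_reyssat13`** — `¬ RHSzpiroBadCut.I06StarCellsAt T` for every such `T`: at `x₀` and the top label `j = 6` (`i = 5`),
   `h_Θ − h_q = 35·(10/13) = 350/13 > b_e + 1` because `b_e ≤ 1 + log₃ e ≤ 1 + log₃ [K:ℚ] ≤ 1 + log₃(184320·13⁴) < 22`. Hence the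
   corollary **`not_window_of_hStar_reyssat13`**: under `HStarSzpiroBadCut`, IF `(ratPoint (2/23⁵), 13)` is admissible and Szpiro-bad (hypotheses,
   exactly the antecedents of p450130), then NO Θ-volume datum at it lies in the window — the kernel form of the row-2 KILL «H⋆₂ is refuted by
   the first Szpiro-bad window datum that exists» (R-W WINDOW-TABLE v3: this datum is reported Szpiro-bad, margin −0.333, and in the window).
[cite: Mochizuki2012, IUTchI Def. 3.1 p. 61, Ex. 3.2 (iv) p. 71; IUTchIV Prop. 1.2 (i) p. 10, Thm. 1.10 proof Step (ii) p. 24, Cor. 2.2 (ii) proof (P5) p. 46]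
[cite: MochizukiAbsTopIII2015, Def 5.4 (iii) p. 126] [cite: DupuyHilado2025, §3.3, §3.4] [claim: Mochizuki2012, status: disputed] for every IUT locution.
Axioms: standard. No instance, no notation.
-/

noncomputable section

open Set Metric Function NumberField IsDedekindDomain
open scoped Pointwise

namespace Summit.ABC.IUTFork.Repair.RHSzpiroBadCutReyssat

open Thm311 Thm311.Real Cor312 Cor312Vol Cor312Prov Literature.IUT.LogThetaLattice Literature.IUT.LogVolume
  Literature.IUT.HodgeTheaters Literature.IUT.LogVolume.ThetaData Literature.AnabelianGeometry.AbsoluteAnabelian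
  Literature.NumberTheory.NumberFields Literature.NumberTheory.DiophantineGeometry
open Literature.NumberTheory.DiophantineGeometry.GenEll
open Summit.ABC.IUTFork.Repair.EvalI06StarGenuine Summit.ABC.IUTFork.Repair.RHSzpiroBadCut

/-! ## §1. The `j`-invariant of the Reyssat point and its `3`-adic order -/

/-- **`j(2/23⁵) = 2⁸·N³ / (M²·3²⁰)`** for the Legendre parameter `λ = a/c` of the abc triple `(a, b, c) = (2, 3¹⁰·109, 23⁵)`
(`j = 2⁸(λ²−λ+1)³/(λ²(λ−1)²) = 2⁸(a²−ac+c²)³/(abc)²`, `N = a² − ac + c² = 41426498340967`, `abc = 3¹⁰·M`, `M = 2·109·23⁵ = 1403122774`). [folklore] -/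
theorem jInv_reyssat_eq :
    Cor22.jInv ((2 : ℚ) / 6436343) =
      ((18200136324246302523427127835319106818832128 : ℕ) : ℚ) / (((1968753518917455076 : ℕ) : ℚ) * (3 : ℚ) ^ 20) := by
  unfold Cor22.jInv
  norm_num

/-- A natural number prime to the prime under `v` has `ord_v = 0` (campaign-S `valuation_natCast_eq_one_iff`). [folklore] -/
private theorem ord_natCast_eq_zero_of_not_dvd'' (v : HeightOneSpectrum (𝓞 ℚ)) {n : ℕ}
    (h : ¬ Rat.HeightOneSpectrum.natGenerator v ∣ n) : ord ℚ v (n : ℚ) = 0 := by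
  unfold ord
  rw [(UniformABCConjecture.valuation_natCast_eq_one_iff v n).2 h, WithZero.log_one, neg_zero]

/-- **`ord_v j(2/23⁵) = −20`** at the place `v` of `ℚ` over `3` (`3 ∤ 2⁸N³`, `3 ∤ M²`, `ord_v 3 = 1`): the local height `ord₃(q_E) = 20 = 2·ord₃(abc)`
of the Frey–Legendre curve of the Reyssat triple at `3`. [folklore] -/
theorem ord_jInv_reyssat (v : HeightOneSpectrum (𝓞 ℚ)) (hv : Rat.HeightOneSpectrum.natGenerator v = 3) :
    ord ℚ v (Cor22.jInv ((2 : ℚ) / 6436343)) = -20 := by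
  have hA : ¬ Rat.HeightOneSpectrum.natGenerator v ∣ 18200136324246302523427127835319106818832128 := by rw [hv]; norm_num
  have hB : ¬ Rat.HeightOneSpectrum.natGenerator v ∣ 1968753518917455076 := by rw [hv]; norm_num
  have hA0 : ((18200136324246302523427127835319106818832128 : ℕ) : ℚ) ≠ 0 := by positivity
  have hB0 : ((1968753518917455076 : ℕ) : ℚ) ≠ 0 := by positivity
  have h30 : (3 : ℚ) ^ 20 ≠ 0 := pow_ne_zero _ (by norm_num)
  have h3 : ord ℚ v (3 : ℚ) = 1 := by
    have := Cor22.ord_natGenerator_eq_one v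
    rwa [hv, Nat.cast_ofNat] at this
  rw [jInv_reyssat_eq, div_eq_mul_inv, ord_mul ℚ v hA0 (inv_ne_zero (mul_ne_zero hB0 h30)), ord_inv,
    ord_mul ℚ v hB0 h30, ord_pow, ord_natCast_eq_zero_of_not_dvd'' v hA, ord_natCast_eq_zero_of_not_dvd'' v hB, h3]
  norm_num

/-! ## §2. The bad place over `3` of every Θ-volume datum at `(ratPoint (2/23⁵), 13)` and the norm of the chosen q-idele there -/

/-- **For every `T : Cor22.ThetaVolumeDatumAt (ratPoint (2/23⁵)) 13` there is a fibre point `x₀ | 3`, BAD for `pilotDataOfK T.D T.K`, at which the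
CHOSEN realising q-idele has `‖t_q(x₀)‖ = 3^{−20/(2·13)}`** (`3 ≠ 2, 13`; `ord₃ j = −20`; abc-iut-w4-d026's (H4) package; the fibre is nonempty).
[cite: Mochizuki2012, IUTchIV Cor. 2.2 (ii) proof (P5) p. 46; IUTchI Ex. 3.2 (iv) p. 71] [cite: DupuyHilado2025, §3.4] -/
theorem exists_bad_place_three_reyssat (T : Cor22.ThetaVolumeDatumAt (ratPoint ((2 : ℚ) / 6436343)) 13) :
    letI := T.instFieldF; letI := T.instNumberFieldF; letI := T.instAlgebraF; letI := T.instFieldK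
    letI := T.instNumberFieldK; letI := T.instAlgebraK; letI := T.instFieldFbar; letI := T.instAlgebraFbar
    letI := T.instAlgebraKFbar; letI := T.instIsElliptic
    haveI : Fact (Nat.Prime 3) := ⟨by norm_num⟩
    ∃ x₀ : (thetaIndex (pilotDataOfK T.D T.K)).Fibre (.inr ⟨3, by norm_num⟩),
      placeOf (pilotDataOfK T.D T.K) 3 x₀ ∈ (pilotDataOfK T.D T.K).S ∧
      ‖(exists_realising_qIdeles_pilotDataOfK T.D).choose ⟨3, by norm_num⟩ x₀‖ = (3 : ℝ) ^ (((-20 : ℤ) : ℝ) / (2 * (13 : ℕ))) := by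
  letI := T.instFieldF; letI := T.instNumberFieldF; letI := T.instAlgebraF; letI := T.instFieldK
  letI := T.instNumberFieldK; letI := T.instAlgebraK; letI := T.instFieldFbar; letI := T.instAlgebraFbar
  letI := T.instAlgebraKFbar; letI := T.instIsElliptic
  haveI : Fact (Nat.Prime 3) := ⟨by norm_num⟩
  obtain ⟨v, hv⟩ := (thetaIndex (pilotDataOfK T.D T.K)).fibre_nonempty (.inr ⟨3, by norm_num⟩)
  let x₀ : (thetaIndex (pilotDataOfK T.D T.K)).Fibre (.inr ⟨3, by norm_num⟩) := ⟨v, hv⟩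
  have hord : ∀ u : HeightOneSpectrum (𝓞 ℚ), Rat.HeightOneSpectrum.natGenerator u = ((⟨3, by norm_num⟩ : Nat.Primes) : ℕ) →
      ord ℚ u (Cor22.jInv ((2 : ℚ) / 6436343)) ≤ -((20 : ℕ) : ℤ) := fun u hu => by
    rw [ord_jInv_reyssat u hu]; norm_num
  have h := norm_chosenQIdele_le_rpow_of_ratPoint' T.D ((2 : ℚ) / 6436343) T.j_eq T.isP5Choice ⟨3, by norm_num⟩ x₀
    (by norm_num) (by norm_num) 20 (by norm_num) hord
  have hS := h.1
  have hjF : T.E.j = ((Cor22.jInv ((2 : ℚ) / 6436343) : ℚ) : T.F) := by rw [T.j_eq]; exact eq_ratCast _ _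
  refine ⟨x₀, hS, ?_⟩
  rw [norm_chosenQIdele_eq_rpow_ord_rat' T.D ⟨3, by norm_num⟩ x₀ hS _ hjF,
    ord_jInv_reyssat _ (natGenerator_finBelow_placeOf T.D ⟨3, by norm_num⟩ x₀)]
  have h3c : (((⟨3, by norm_num⟩ : Nat.Primes) : ℕ) : ℝ) = 3 := by norm_num
  rw [h3c]

/-! ## §3. The I06⋆ data clause FAILS at every Θ-volume datum at `(ratPoint (2/23⁵), 13)` — MODEL-FREE -/

/-- **ROW-2 KILL AT A NAMED GENUINE DATUM CLASS (kernel, model-free).** For EVERY Θ-volume datum `T` at the Reyssat point with `l = 13`,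
`¬ RHSzpiroBadCut.I06StarCellsAt T`: at the bad place `x₀ | 3` of §2 and the top label `j = 6` the two-element cell `t_q(x₀) ∈ t_{Θ,6}(x₀)·ℐ_{x₀}`
would force `h_Θ − h_q = 35·(10/13) ≤ b_e + 1`, but `b_e ≤ 1 + log₃ e_{x₀} ≤ 1 + log₃(184320·13⁴) < 22` (`e_{x₀} ≤ [K : ℚ] ≤ 184320·13⁴`,
[IUTchIV] Thm. 1.10 Step (ii)). No local-type model, no table. [cite: Mochizuki2012, IUTchIV Prop. 1.2 (i) p. 10, Thm. 1.10 proof Step (ii) p. 24]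
[cite: MochizukiAbsTopIII2015, Def 5.4 (iii) p. 126] [claim: Mochizuki2012, status: disputed] -/
theorem not_i06StarCellsAt_reyssat13 (T : Cor22.ThetaVolumeDatumAt (ratPoint ((2 : ℚ) / 6436343)) 13) :
    ¬ I06StarCellsAt T := by
  letI := T.instFieldF; letI := T.instNumberFieldF; letI := T.instAlgebraF; letI := T.instFieldK
  letI := T.instNumberFieldK; letI := T.instAlgebraK; letI := T.instFieldFbar; letI := T.instAlgebraFbar
  letI := T.instAlgebraKFbar; letI := T.instIsElliptic
  haveI h3F : Fact (Nat.Prime 3) := ⟨by norm_num⟩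
  intro hcells
  obtain ⟨x₀, hS, hnorm⟩ := exists_bad_place_three_reyssat T
  -- the top label `j = 6` (`i = 5 < l⋆ = (13 − 1)/2 = 6`)
  have hl6 : 5 < (thetaIndex (pilotDataOfK T.D T.K)).lstar := by
    show 5 < ((pilotDataOfK T.D T.K).l - 1) / 2
    rw [pilotDataOfK_l]; norm_num
  let i₅ : Fin (thetaIndex (pilotDataOfK T.D T.K)).lstar := ⟨5, hl6⟩
  have hcell := hcells ⟨3, by norm_num⟩ i₅ x₀ hS
  -- the chosen realising ideles and their norm relation `‖t_Θ,i‖ = ‖t_q‖^{(i+1)²}`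
  set tq := (exists_realising_qIdeles_pilotDataOfK T.D).choose with htqdef
  set t := (exists_realising_thetaIdeles_pilotDataOfK T.D).choose with htdef
  have hpow : ‖t ⟨3, by norm_num⟩ i₅ x₀‖ = ‖tq ⟨3, by norm_num⟩ x₀‖ ^ (((i₅ : ℕ) + 1) ^ 2) :=
    norm_thetaIdele_eq_pow_of_realises (pilotDataOfK T.D T.K) t (exists_realising_thetaIdeles_pilotDataOfK T.D).choose_spec.1
      (exists_realising_thetaIdeles_pilotDataOfK T.D).choose_spec.2.2 tq (exists_realising_qIdeles_pilotDataOfK T.D).choose_spec.1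
      (exists_realising_qIdeles_pilotDataOfK T.D).choose_spec.2.2 ⟨3, by norm_num⟩ i₅ x₀
  have ht0 : t ⟨3, by norm_num⟩ i₅ x₀ ≠ 0 := (exists_realising_thetaIdeles_pilotDataOfK T.D).choose_spec.1 _ _ _
  -- heights: `‖t_q‖ = 3^{−10/13}`, `‖t_Θ,6‖ = 3^{−360/13}`
  have h3pos : (0 : ℝ) < ((3 : ℕ) : ℝ) := by norm_num
  have hun : ‖tq ⟨3, by norm_num⟩ x₀‖ = ((3 : ℕ) : ℝ) ^ (-((10 : ℝ) / 13)) := by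
    rw [htqdef, hnorm]; push_cast; norm_num
  have htn : ‖t ⟨3, by norm_num⟩ i₅ x₀‖ = ((3 : ℕ) : ℝ) ^ (-((360 : ℝ) / 13)) := by
    rw [hpow, hun, ← Real.rpow_natCast, ← Real.rpow_mul h3pos.le]
    congr 1
    show -((10 : ℝ) / 13) * (((5 + 1) ^ 2 : ℕ) : ℝ) = -(360 / 13)
    norm_num
  -- the degree chain at `x₀`: `b_e ≤ 1 + log₃ e ≤ 1 + log₃ (184320·13⁴) < 22`
  have he1 : 1 ≤ absRamificationIdx 3 (kOf (pilotDataOfK T.D T.K) 3 x₀) := absRamificationIdx_pos 3 _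
  have hchainN : absRamificationIdx 3 (kOf (pilotDataOfK T.D T.K) 3 x₀) ≤ 184320 * 13 ^ 4 :=
    ((Literature.IUT.LogVolume.absRamificationIdx_le_finrank 3 (kOf (pilotDataOfK T.D T.K) 3 x₀)).trans
      (finrank_kOf_le (pilotDataOfK T.D T.K) ⟨3, by norm_num⟩ x₀)).trans T.finrank_rat_K_le_ratPoint
  have hchainR : (absRamificationIdx 3 (kOf (pilotDataOfK T.D T.K) 3 x₀) : ℝ) ≤ ((184320 * 13 ^ 4 : ℕ) : ℝ) := by exact_mod_cast hchainN
  have heR : (1 : ℝ) ≤ (absRamificationIdx 3 (kOf (pilotDataOfK T.D T.K) 3 x₀) : ℝ) := by exact_mod_cast he1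
  have hb : logRadiusB 3 (absRamificationIdx 3 (kOf (pilotDataOfK T.D T.K) 3 x₀)) ≤
      1 + Real.logb (3 : ℝ) (absRamificationIdx 3 (kOf (pilotDataOfK T.D T.K) 3 x₀) : ℝ) := by
    have h := Literature.IUT.LogVolume.logRadiusB_le 3 (by norm_num) he1
    norm_num at h ⊢
    exact h
  have hlogb : Real.logb 3 (absRamificationIdx 3 (kOf (pilotDataOfK T.D T.K) 3 x₀) : ℝ) ≤ Real.logb 3 ((184320 * 13 ^ 4 : ℕ) : ℝ) :=
    Real.logb_le_logb_of_le (by norm_num) (by linarith) hchainR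
  have hlog21 : Real.logb 3 ((184320 * 13 ^ 4 : ℕ) : ℝ) < 21 := by
    rw [Real.logb_lt_iff_lt_rpow (by norm_num) (by positivity)]
    have : ((184320 * 13 ^ 4 : ℕ) : ℝ) < (3 : ℝ) ^ (21 : ℕ) := by norm_num
    simpa [Real.rpow_natCast] using this
  have hc : ((if (3 : ℕ) = 2 then 2 else 1 : ℕ) : ℝ) = 1 := by norm_num
  have hbnd : logRadiusB 3 (absRamificationIdx 3 (kOf (pilotDataOfK T.D T.K) 3 x₀)) < 22 := by
    have h1 : Real.logb (3 : ℝ) (absRamificationIdx 3 (kOf (pilotDataOfK T.D T.K) 3 x₀) : ℝ) < 21 := lt_of_le_of_lt hlogb hlog21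
    linarith [hb, h1]
  refine not_mem_smul_logShell_of_lt 3 (kOf (pilotDataOfK T.D T.K) 3 x₀) ht0 hun htn ?_ hcell
  rw [hc]
  have h23 : (23 : ℝ) ≤ 360 / 13 - 10 / 13 := by norm_num
  linarith [hbnd, h23]

/-- **COROLLARY (the row-2 KILL in kernel shape).** Under `H⋆₂ = HStarSzpiroBadCut`: IF the Reyssat point with `l = 13` is admissible
(`∈ UP`, `AdmitsCore`, `CondP2/P5/P6`) and Szpiro-bad in the sense of p450130 (hypotheses — R-W WINDOW-TABLE v3 reports margin `−0.333`, P6 EXPECTED),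
then NO Θ-volume datum at `(ratPoint (2/23⁵), 13)` lies in the window (¬deep) — i.e. `H⋆₂` is refuted by the first window datum that EXISTS there
(`not_hStar_of_witness`); existence of initial Θ-data at this point is NOT claimed here. [claim: Mochizuki2012, status: disputed] -/
theorem not_window_of_hStar_reyssat13 (hH : HStarSzpiroBadCut) (hP : ratPoint ((2 : ℚ) / 6436343) ∈ UP)
    (hc : Cor22.AdmitsCore (ratPoint ((2 : ℚ) / 6436343))) (h2 : Cor22.CondP2 (ratPoint ((2 : ℚ) / 6436343)) 13)
    (h5' : Cor22.CondP5 (ratPoint ((2 : ℚ) / 6436343)) 13) (h6 : Cor22.CondP6 (ratPoint ((2 : ℚ) / 6436343)) 13)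
    (hbad : (((13 : ℕ) : ℝ) + 5) / 4 < (Cor22.dmod (ratPoint ((2 : ℚ) / 6436343)) : ℝ) ∨
      6 * (13 : ℕ) * ((((13 : ℕ) : ℝ) + 5) - 4 * Cor22.dmod (ratPoint ((2 : ℚ) / 6436343))) / ((((13 : ℕ) : ℝ) + 4) * (((13 : ℕ) : ℝ) - 3))
          * ((ratPoint ((2 : ℚ) / 6436343)).logDiff + (1 - 1 / ((13 : ℕ) : ℝ)) * Cor22.logCondAvoid (ratPoint ((2 : ℚ) / 6436343)) {2, 13})
        + 6 * (13 : ℕ) * (((13 : ℕ) : ℝ) + 5) / ((((13 : ℕ) : ℝ) + 4) * (((13 : ℕ) : ℝ) - 3)) * Real.log Real.pi <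
          Cor22.logQAvoid (ratPoint ((2 : ℚ) / 6436343)) {2, 13})
    (T : Cor22.ThetaVolumeDatumAt (ratPoint ((2 : ℚ) / 6436343)) 13) :
    letI := T.instFieldF; letI := T.instNumberFieldF; letI := T.instAlgebraF; letI := T.instFieldK
    letI := T.instNumberFieldK; letI := T.instAlgebraK; letI := T.instFieldFbar; letI := T.instAlgebraFbar
    letI := T.instAlgebraKFbar; letI := T.instIsElliptic
    ∃ (pp : Nat.Primes) (_ : 2 < (pp : ℕ)) (i : Fin (thetaIndex (pilotDataOfK T.D T.K)).lstar)
        (x₀ : (thetaIndex (pilotDataOfK T.D T.K)).Fibre (.inr pp)),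
      haveI : Fact (pp : ℕ).Prime := ⟨pp.2⟩
      ((pp : ℕ) : ℝ) ^ ((((i : ℕ) : ℝ) + 2) * (4 + 2 * Real.logb (pp : ℕ) (Module.finrank ℚ T.K)) + 1) *
        ‖(exists_realising_qIdeles_pilotDataOfK T.D).choose pp x₀‖ ^ (((i : ℕ) + 1) ^ 2 - 1) < 1 := by
  by_contra hwin
  exact not_i06StarCellsAt_reyssat13 T (hH _ hP 13 (by norm_num) (by norm_num) hc h2 h5' h6 hbad T hwin)

/-! ## §4 (v2 append). THE GENERAL `λ`-LINE CRITERION: a pole of `j(λ)` of order `≥ h` at `p ≠ 2, l` with `2l·(2 + log_p(184320·l⁴)) < ((i+1)² − 1)·h`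
kills the I06⋆ data clause of EVERY Θ-volume datum at `(ratPoint λ, l)` — each further Szpiro-bad Frey row of R-W's table becomes a kernel NEG by ONE
`ord_p j(λ)` computation (§1 is the Reyssat instance). -/

/-- **MODEL-FREE NEG AT A RATIONAL `λ`-LINE POINT.** Let `T : Cor22.ThetaVolumeDatumAt (ratPoint q) l`, `p ≠ 2, l` a prime at which `j(q)` has a pole
of order `≥ h ≥ 1` (`ord_u j(q) ≤ −h` at the place `u = (p)` of `ℚ`), and a label index `i < l⋆ = (l−1)/2` with `2l·(2 + log_p(184320·l⁴)) < ((i+1)² − 1)·h`.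
Then `¬ I06StarCellsAt T`: every fibre point `x₀ | p` is BAD with `‖t_q(x₀)‖ ≤ p^{−h/(2l)}` (abc-iut-w4-d026), so with `h_q := −log_p ‖t_q(x₀)‖ ≥ h/(2l)`
and `‖t_{Θ,i+1}(x₀)‖ = ‖t_q(x₀)‖^{(i+1)²}` the two-element NEG door needs `b_e + 1 < ((i+1)²−1)·h_q`, and `b_e ≤ 1 + log_p e ≤ 1 + log_p(184320·l⁴)`
([IUTchIV] Thm. 1.10 Step (ii) degree bound). No local-type model, no table; existence of `T` not claimed.
[cite: Mochizuki2012, IUTchIV Prop. 1.2 (i) p. 10, Thm. 1.10 proof Step (ii) p. 24, Cor. 2.2 (ii) proof (P5) p. 46] [cite: MochizukiAbsTopIII2015, Def 5.4 (iii) p. 126]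
[claim: Mochizuki2012, status: disputed] -/
theorem not_i06StarCellsAt_ratPoint_of_ord_le {q : ℚ} {l : ℕ} (T : Cor22.ThetaVolumeDatumAt (ratPoint q) l)
    (pp : Nat.Primes) (hp2 : (pp : ℕ) ≠ 2) (hpl : (pp : ℕ) ≠ l) (h : ℕ) (hh : 1 ≤ h)
    (hord : ∀ u : HeightOneSpectrum (𝓞 ℚ), Rat.HeightOneSpectrum.natGenerator u = (pp : ℕ) → ord ℚ u (Cor22.jInv q) ≤ -(h : ℤ))
    (i : ℕ) (hi : i < (l - 1) / 2)
    (hineq : 2 * (l : ℝ) * (2 + Real.logb (pp : ℕ) ((184320 * l ^ 4 : ℕ) : ℝ)) < ((((i : ℕ) : ℝ) + 1) ^ 2 - 1) * h) :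
    ¬ I06StarCellsAt T := by
  letI := T.instFieldF; letI := T.instNumberFieldF; letI := T.instAlgebraF; letI := T.instFieldK
  letI := T.instNumberFieldK; letI := T.instAlgebraK; letI := T.instFieldFbar; letI := T.instAlgebraFbar
  letI := T.instAlgebraKFbar; letI := T.instIsElliptic
  haveI hpF : Fact (pp : ℕ).Prime := ⟨pp.2⟩
  intro hcells
  -- a fibre point over `p`; it is BAD and carries the norm bound of the chosen q-idele
  obtain ⟨v, hv⟩ := (thetaIndex (pilotDataOfK T.D T.K)).fibre_nonempty (.inr pp)
  let x₀ : (thetaIndex (pilotDataOfK T.D T.K)).Fibre (.inr pp) := ⟨v, hv⟩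
  obtain ⟨hS, hle⟩ := norm_chosenQIdele_le_rpow_of_ratPoint' T.D q T.j_eq T.isP5Choice pp x₀ hp2 hpl h hh hord
  -- the label `j = i+1`
  have hil : i < (thetaIndex (pilotDataOfK T.D T.K)).lstar := by
    show i < ((pilotDataOfK T.D T.K).l - 1) / 2
    rw [pilotDataOfK_l]; exact hi
  let iℓ : Fin (thetaIndex (pilotDataOfK T.D T.K)).lstar := ⟨i, hil⟩
  have hcell := hcells pp iℓ x₀ hS
  set tq := (exists_realising_qIdeles_pilotDataOfK T.D).choose with htqdef
  set t := (exists_realising_thetaIdeles_pilotDataOfK T.D).choose with htdef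
  have hpow : ‖t pp iℓ x₀‖ = ‖tq pp x₀‖ ^ (((iℓ : ℕ) + 1) ^ 2) :=
    norm_thetaIdele_eq_pow_of_realises (pilotDataOfK T.D T.K) t (exists_realising_thetaIdeles_pilotDataOfK T.D).choose_spec.1
      (exists_realising_thetaIdeles_pilotDataOfK T.D).choose_spec.2.2 tq (exists_realising_qIdeles_pilotDataOfK T.D).choose_spec.1
      (exists_realising_qIdeles_pilotDataOfK T.D).choose_spec.2.2 pp iℓ x₀
  have ht0 : t pp iℓ x₀ ≠ 0 := (exists_realising_thetaIdeles_pilotDataOfK T.D).choose_spec.1 _ _ _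
  have hq0 : 0 < ‖tq pp x₀‖ := norm_pos_iff.2 ((exists_realising_qIdeles_pilotDataOfK T.D).choose_spec.1 _ _)
  -- heights read off the norms: `‖t_q‖ = p^{−H_q}` with `H_q := −log_p ‖t_q‖ ≥ h/(2l)`, `‖t_Θ‖ = p^{−(i+1)²·H_q}`
  have hp1 : (1 : ℝ) < ((pp : ℕ) : ℝ) := by exact_mod_cast pp.2.one_lt
  have hp0 : (0 : ℝ) < ((pp : ℕ) : ℝ) := by linarith
  have hhq' : (h : ℝ) / (2 * l) ≤ -Real.logb (pp : ℕ) ‖tq pp x₀‖ := by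
    have h1 : Real.logb (pp : ℕ) ‖tq pp x₀‖ ≤ Real.logb (pp : ℕ) (((pp : ℕ) : ℝ) ^ (-(h : ℝ) / (2 * l))) :=
      Real.logb_le_logb_of_le hp1 hq0 hle
    rw [Real.logb_rpow hp0 hp1.ne'] at h1
    rw [neg_div] at h1
    linarith
  obtain ⟨Hq, hun, hhq⟩ : ∃ Hq : ℝ, ‖tq pp x₀‖ = ((pp : ℕ) : ℝ) ^ (-Hq) ∧ (h : ℝ) / (2 * l) ≤ Hq :=
    ⟨-Real.logb (pp : ℕ) ‖tq pp x₀‖, by rw [neg_neg, Real.rpow_logb hp0 hp1.ne' hq0], hhq'⟩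
  have htn : ‖t pp iℓ x₀‖ = ((pp : ℕ) : ℝ) ^ (-(((((i : ℕ) : ℝ) + 1) ^ 2) * Hq)) := by
    rw [hpow, hun, ← Real.rpow_natCast, ← Real.rpow_mul hp0.le]
    congr 1
    push_cast
    ring
  -- the degree chain at `x₀`
  have he1 : 1 ≤ absRamificationIdx (pp : ℕ) (kOf (pilotDataOfK T.D T.K) pp.1 x₀) := absRamificationIdx_pos (pp : ℕ) _
  have hchainN : absRamificationIdx (pp : ℕ) (kOf (pilotDataOfK T.D T.K) pp.1 x₀) ≤ 184320 * l ^ 4 :=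
    ((Literature.IUT.LogVolume.absRamificationIdx_le_finrank (pp : ℕ) (kOf (pilotDataOfK T.D T.K) pp.1 x₀)).trans
      (finrank_kOf_le (pilotDataOfK T.D T.K) pp x₀)).trans T.finrank_rat_K_le_ratPoint
  have hchainR : (absRamificationIdx (pp : ℕ) (kOf (pilotDataOfK T.D T.K) pp.1 x₀) : ℝ) ≤ ((184320 * l ^ 4 : ℕ) : ℝ) := by
    exact_mod_cast hchainN
  have heR : (1 : ℝ) ≤ (absRamificationIdx (pp : ℕ) (kOf (pilotDataOfK T.D T.K) pp.1 x₀) : ℝ) := by exact_mod_cast he1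
  have hb : logRadiusB (pp : ℕ) (absRamificationIdx (pp : ℕ) (kOf (pilotDataOfK T.D T.K) pp.1 x₀)) ≤
      1 + Real.logb (pp : ℕ) (absRamificationIdx (pp : ℕ) (kOf (pilotDataOfK T.D T.K) pp.1 x₀) : ℝ) :=
    Literature.IUT.LogVolume.logRadiusB_le (pp : ℕ) pp.2.one_lt he1
  have hlogb : Real.logb (pp : ℕ) (absRamificationIdx (pp : ℕ) (kOf (pilotDataOfK T.D T.K) pp.1 x₀) : ℝ) ≤
      Real.logb (pp : ℕ) ((184320 * l ^ 4 : ℕ) : ℝ) :=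
    Real.logb_le_logb_of_le hp1 (by linarith) hchainR
  have hc : ((if (pp : ℕ) = 2 then 2 else 1 : ℕ) : ℝ) = 1 := by rw [if_neg hp2]; norm_num
  -- assemble
  have hl0 : (0 : ℝ) < 2 * (l : ℝ) := by
    have : 1 ≤ l := by omega
    have : (1 : ℝ) ≤ l := by exact_mod_cast this
    linarith
  have hj0 : (0 : ℝ) ≤ (((i : ℕ) : ℝ) + 1) ^ 2 - 1 := by nlinarith [(Nat.cast_nonneg (α := ℝ) i)]
  have hkey : 2 + Real.logb (pp : ℕ) ((184320 * l ^ 4 : ℕ) : ℝ) < ((((i : ℕ) : ℝ) + 1) ^ 2 - 1) * ((h : ℝ) / (2 * l)) := by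
    rw [← mul_div_assoc, lt_div_iff₀ hl0]
    linarith
  have hmono : ((((i : ℕ) : ℝ) + 1) ^ 2 - 1) * ((h : ℝ) / (2 * l)) ≤ ((((i : ℕ) : ℝ) + 1) ^ 2 - 1) * Hq :=
    mul_le_mul_of_nonneg_left hhq hj0
  refine not_mem_smul_logShell_of_lt (pp : ℕ) (kOf (pilotDataOfK T.D T.K) pp.1 x₀) ht0 hun htn ?_ hcell
  rw [hc]
  have hring : (((((i : ℕ) : ℝ) + 1) ^ 2) * Hq) - Hq = ((((i : ℕ) : ℝ) + 1) ^ 2 - 1) * Hq := by ring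
  rw [hring]
  linarith [hb, hlogb, hkey, hmono]

/-- **Reyssat again, through the general criterion** (`p = 3`, `h = 20`, `l = 13`, `i = 5`: `26·(2 + log₃(184320·13⁴)) < 26·23 = 598 < 700 = 35·20`) —
the §3 theorem as a one-line instance of §4. [claim: Mochizuki2012, status: disputed] -/
theorem not_i06StarCellsAt_reyssat13' (T : Cor22.ThetaVolumeDatumAt (ratPoint ((2 : ℚ) / 6436343)) 13) :
    ¬ I06StarCellsAt T := by
  refine not_i06StarCellsAt_ratPoint_of_ord_le T ⟨3, by norm_num⟩ (by norm_num) (by norm_num) 20 (by norm_num)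
    (fun u hu => by rw [ord_jInv_reyssat u hu]; norm_num) 5 (by norm_num) ?_
  have hlog21 : Real.logb (((⟨3, by norm_num⟩ : Nat.Primes) : ℕ) : ℕ) ((184320 * 13 ^ 4 : ℕ) : ℝ) < 21 := by
    have h3 : ((((⟨3, by norm_num⟩ : Nat.Primes) : ℕ) : ℕ) : ℝ) = 3 := by norm_num
    rw [h3, Real.logb_lt_iff_lt_rpow (by norm_num) (by positivity)]
    have : ((184320 * 13 ^ 4 : ℕ) : ℝ) < (3 : ℝ) ^ (21 : ℕ) := by norm_num
    simpa [Real.rpow_natCast] using this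
  push_cast at hlog21 ⊢
  nlinarith [hlog21]

end Summit.ABC.IUTFork.Repair.RHSzpiroBadCutReyssat

end
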